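import Summits.BirchSwinnertonDyer.BirchSwinnertonDyer.Theorems.KimAtThreeDeepLowerOffKatoStratumAssemblyFineKato
import Summits.BirchSwinnertonDyer.BirchSwinnertonDyer.Theorems.KimAtThreeOffStratumTorsionRowsOfFineKato
import HarnessLib

/-!
# Route `KimAtThreeKolyvagin` (rung W2): crux 19679 `DeepLowerAtThreeOffKatoStratum` and its parent 19075
# `DeepLowerAtThree` BY NAME after this seat's gen 4 — the `t ≥ 1` additive rows no longer display their own
# conclusion (cell `bsd-addord`, seat `bsd-addord-w2-acc3` (PROGRAMME PART 1b row (3)), gen 4)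

HONEST FRAMING. CONDITIONAL assembly theorems (every displayed input is a hypothesis; no definition, no named fact, no
`sorry`); they do NOT close items 19679 / 19075 (their OWNER assembles / the planner declares the residual); nothing
booked; BSD is not proved by any of this.  `--supports` stmt-BirchSwinnertonDyer-19679.

## What

This seat's gen-3 `KimAtThreeDeepLowerOffKatoStratumAssemblyFineKato` §B/§C gave 19679 / 19075 BY NAME from seat acc2 gen 3's
non-additive stub theorem (11 PUB facts + K3 leaf `SignedSupersingular` + `X11a.TargetThree` + (TD)) and this seat's
additive stub theorem from [S24] + GZK + PT + (C1₂) + **(R₁) = the crux's conclusion displayed on every `t ≥ 1`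
additive row**.  Gen 4 (`KimAtThreeOffStratumTorsionRowsOfFineKato.stub19679_additiveDefect_of_fineKato_of_fineKatoT`, on
the port-free LOWER END `KimAtThreeDeepLowerAdditiveTorsionEndOfZetaBody` / ★★-stable / THEOREM D-u PAIR-STABLE) replaces
(R₁) by the fine Kato package (C1₂ᵗ) at torsion exponent `t` + the S24-DEEP ports.  This file is §B/§C re-run on it:

* §D `deepLowerAtThreeOffKatoStratum_of_cornerKeys_of_fineKato_of_fineKatoT` — 19679 BY NAME ⟸ acc2's inputs (as in §B)
  + [S24] (1)(2) + S24-DEEP (1)(2) + GZK + PT + (C1₂) + (C1₂ᵗ).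
* §E `deepLowerAtThree_of_katoStratumSharedParts_of_cornerKeys_of_fineKato_of_fineKatoT` — parent 19075 BY NAME ⟸ alias
  19678 + the same (via w2-c2's §L glue), [S24]/GZK/PT taken from the alias.

= THE KERNEL STATEMENT OF 19679's RESIDUAL AFTER THIS SEAT'S GEN 4: its displayed hypotheses.  Versus §B/§C: `hTors`
(R₁) is GONE; in its place `hS24d`/`hS24d₂` (FLAG `S24-DEEP-PORT@3`, discharged modulo the pinned [S24] facts by seat
w2-c2 gen 5, re-key pending) and `hC1t` (C1₂ᵗ) (the same construction-shaped object as (C1₂), read at torsion exponent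
`t`; `defn-BlochKatoDualExponential` lane).  Credit: acc2 gen 3 (non-additive half), w2-c2 (glue, deep family), acc6,
w2-c3, kim3, team n1011; this seat composes.
References: [Kim2025RefinedTNC] Thm 1.1, §8.1.2; [Kim2022StructureSelmer] Thm. 1.9 (6), Thm. 3.13, Conj. 1.10;
[Sakamoto2024] Thm. 4.4; [MazurRubin2004] Thm. 5.2.12, App. A Prop. A.2; [Kato2004Asterisque] §9.4, Thm. 9.7, Ex. 13.3;
[YanZhu2024MainConjNonCM] Thm. 4.15; [Wuthrich2014] Lemma 20, Prop. 21; [Skinner2016PacificMC] Thm. C; [Miller2011LMS]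
Thm. 1.2; [Mazur1978] Cor. 4.1; [Ribet1990] Thm. 1.1.
-/

set_option autoImplicit false
-- the Theorems namespace of a single-conjunct summit repeats the summit name by design (D-0017)
set_option linter.dupNamespace false

noncomputable section

open scoped NumberField TensorProduct ContRepresentation Classical MatrixGroups ModularForm
open Field Finset IsDedekindDomain NumberField WeierstrassCurve Rat.HeightOneSpectrum CongruenceSubgroup
open Literature.NumberTheory.GaloisRepresentations Literature.NumberTheory.GaloisCohomology
open Literature.NumberTheory.GaloisRepresentations.DiscreteGaloisModule
open Literature.NumberTheory.EllipticCurves Literature.NumberTheory.EllipticCurves.ModularForms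
open Literature.NumberTheory.EllipticCurves.Rank1Residual
open Literature.NumberTheory.EllipticCurves.Rank1Residual.Typed
open Literature.NumberTheory.EllipticCurves.Skinner2016
open Literature.NumberTheory.Automorphic
open Literature.NumberTheory.EllipticCurves.Kato2004
open Literature.NumberTheory.EllipticCurves.Kato2004.EulerSystemValues
open Summit.BirchSwinnertonDyer.Rank1Residual
open Summit.BirchSwinnertonDyer.Rank1Residual.GaloisImage
open Summit.BirchSwinnertonDyer.BirchSwinnertonDyer.Theses.KimAtThreeKolyvagin
open Summit.BirchSwinnertonDyer.BirchSwinnertonDyer.Theorems.Rank1ResidualX1Defs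
open Summit.BirchSwinnertonDyer.BirchSwinnertonDyer.Theorems.KimAtThreeKolyvaginDefs
open Summit.BirchSwinnertonDyer.BirchSwinnertonDyer.Theorems.KimAtThreeOffStratumAdditiveDefectOfFineKato
open Summit.BirchSwinnertonDyer.BirchSwinnertonDyer.Theorems.KimAtThreeDeepLowerOffStratumCornerKeysSharp
open Summit.BirchSwinnertonDyer.BirchSwinnertonDyer.Theorems.KimAtThreeDeepLowerSplitGlue
open Summit.BirchSwinnertonDyer.BirchSwinnertonDyer.Theorems.KimAtThreeDeepLowerOffKatoStratumAssemblyFineKato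
open Summit.BirchSwinnertonDyer.BirchSwinnertonDyer.Theorems.KimAtThreeOffStratumTorsionRowsOfFineKato

namespace Summit.BirchSwinnertonDyer.BirchSwinnertonDyer.Theorems.KimAtThreeDeepLowerOffKatoStratumAssemblyFineKatoT

/-- Local notation: the TWO-EXPONENT rider clause (ii₂) at depth `j`, torsion exponent `t`, defect exponent
`e`, place `v`, for the pair `(Λ, Λf)` (n1011's `KatoExpStarFiniteLevelAt` clause (ii), conclusion `× 3^e`). -/
local notation3 (prettyPrint := false) "RIDER₂⟦" W' ", " j ", " t' ", " e' ", " v' ", " Λ' ", " Λf "⟧" =>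
  ∀ (r : Finset (HeightOneSpectrum (𝓞 ℚ)))
    (Ψ : H1 (tateRep W' 3) (cycSubgroup 3 0 r) →+
      continuousCohomology 1
        (subgroupRep (WeierstrassCurve.torsionGaloisModule W' (((3 : ℕ) : ℤ) ^ j * ((3 : ℕ) : ℤ))).toTopRep
          (cycSubgroup 3 0 r))),
    (∀ (φ : contOneCocycles (subgroupRep (tateRep W' 3).toTopRep (cycSubgroup 3 0 r)))
        (ψ : contOneCocycles
          (subgroupRep (WeierstrassCurve.torsionGaloisModule W' (((3 : ℕ) : ℤ) ^ j * ((3 : ℕ) : ℤ))).toTopRep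
            (cycSubgroup 3 0 r))),
        (∀ g, ((ψ.1 g : geomTorsion W' (((3 : ℕ) : ℤ) ^ j * ((3 : ℕ) : ℤ))) : geomPoints W') =
          TateModule.proj 3 (j + 1) (φ.1 g)) →
        Ψ (oneCocycleClass _ φ) = oneCocycleClass _ ψ) →
    ∀ (y : H1 (tateRep W' 3) (cycSubgroup 3 0 r))
      (κ₀ : galoisCohomology (WeierstrassCurve.torsionGaloisModule W' (((3 : ℕ) : ℤ) ^ j * ((3 : ℕ) : ℤ))) 1)
      (s : ℤ_[3]),
      resSubgroup (WeierstrassCurve.torsionGaloisModule W' (((3 : ℕ) : ℤ) ^ j * ((3 : ℕ) : ℤ))).toTopRep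
          (cycSubgroup 3 0 r) 1 κ₀ = Ψ y →
      galoisCohomology.localization (WeierstrassCurve.torsionGaloisModule W' (((3 : ℕ) : ℤ) ^ j * ((3 : ℕ) : ℤ)))
          (Sum.inr v') 1 κ₀ ∈ propagatedSelmerStructure W' 3 j (Sum.inr v') →
      (∃ l ∈ cycIntLattice 3 (cycLevel 3 0 r),
          (((3 : ℕ) : ℤ_[3]) ^ t') • Λ' 0 r y - ((s : ℚ_[3]) ⊗ₜ[ℚ] (1 : CyclotomicField (cycLevel 3 0 r) ℚ)) =
            (((3 : ℕ) : ℤ_[3]) ^ (j + 1)) • (l : ℚ_[3] ⊗[ℚ] CyclotomicField (cycLevel 3 0 r) ℚ)) →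
      ((3 ^ e' : ℕ) : ZMod (3 ^ (j + 1))) *
        Λf (galoisCohomology.localization
          (WeierstrassCurve.torsionGaloisModule W' (((3 : ℕ) : ℤ) ^ j * ((3 : ℕ) : ℤ))) (Sum.inr v') 1 κ₀) =
        PadicInt.toZModPow (j + 1) s

/-- Local notation: **(C1₂) the FINE KATO PACKAGE in two-exponent form** on the additive-defect rows. -/
local notation3 (prettyPrint := false) "FINEKATO₂" =>
  ∀ (W : WeierstrassCurve ℚ) [W.IsElliptic] [W.IsGloballyMinimal]
    [ContinuousSMul ℤ_[3] (W.tateModule 3)] [Module.Free ℤ_[3] (W.tateModule 3)]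
    [Module.Finite ℤ_[3] (W.tateModule 3)],
    (∀ m : ℕ, W.HasSurjectiveModNGaloisRep (3 ^ m : ℕ)) →
    (haveI : Fact (Nat.Prime 3) := ⟨Nat.prime_three⟩; Addv W 3) →
    Nat.card {Q : (W.baseChange ℚ_[3]).toAffine.Point // (3 : ℕ) • Q = 0} = 1 →
    ∀ (v₃ : HeightOneSpectrum (𝓞 ℚ)), ((3 : ℕ) : 𝓞 ℚ) ∈ v₃.asIdeal →
    ∀ {N : ℕ} [NeZero N] (P : ModularParametrizationData W N), N = W.conductorNorm ℤ →
      (∀ z ∈ P.L.lattice, ∃ w ∈ periodLattice P.f, z = P.c * w) →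
      (3 ∣ (W.baseChange ℚ_[3]).localTamagawaNumber ℤ_[3] ∨ (3 : ℤ) ∣ P.maninConstant) →
      ∃ (ι : (n : ℕ) → (CyclotomicField n ℚ →+* ℂ)) (κK : ℝ)
        (Λ : ∀ (k' : ℕ) (r : Finset (HeightOneSpectrum (𝓞 ℚ))),
          H1 (tateRep W 3) (cycSubgroup 3 k' r) →ₗ[ℤ_[3]]
            ℚ_[3] ⊗[ℚ] CyclotomicField (cycLevel 3 k' r) ℚ)
        (Λfin : ∀ j : ℕ, galoisCohomology
          ((W.torsionGaloisModule (((3 : ℕ) : ℤ) ^ j * ((3 : ℕ) : ℤ))).toLocal (Sum.inr v₃)) 1 →+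
            ZMod (3 ^ (j + 1))) (e : ℕ),
        κK ≠ 0 ∧ (∃ u : ℚ, (u : ℝ) = κK ∧ padicValRat 3 u = 0) ∧
        (∀ j : ℕ,
          (∀ c : ZMod (3 ^ (j + 1)), ∃ x ∈ propagatedSelmerStructure W 3 j (Sum.inr v₃), Λfin j x = c) ∧
          (∀ x ∈ propagatedSelmerStructure W 3 j (Sum.inr v₃),
            Λfin j x = 0 ↔ x ∈ W.kummerSelmerStructure (((3 : ℕ) : ℤ) ^ j * ((3 : ℕ) : ℤ)) (Sum.inr v₃))) ∧
        (∀ j : ℕ, RIDER₂⟦W, j, 0, e, v₃, Λ, Λfin j⟧) ∧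
        ∀ (c d a : ℤ) (A : ℕ), 0 < A → Int.gcd c (6 * 3 * A) = 1 → Int.gcd d (6 * 3 * N) = 1 →
          ∃ (z : ∀ (k' : ℕ) (r : (cyclotomicLevelsRat 3 (badPlaces c d A N)).Ideals),
                H1 (tateRep W 3) ((cyclotomicLevelsRat 3 (badPlaces c d A N)).level k' r.1))
            (x : ∀ (k' : ℕ) (r : (cyclotomicLevelsRat 3 (badPlaces c d A N)).Ideals),
                CyclotomicField (cycLevel 3 k' r.1) ℚ),
            ZetaBody W 3 P.f ι κK Λ c d a A z x

/-- Local notation: **(C1₂ᵗ) the FINE KATO PACKAGE in two-exponent form on the additive rows with `#E(ℚ₃)[3] = 3^t`,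
`1 ≤ t`** — (C1₂) with the row binders `#E(ℚ₃)[3] = 1`, `3 ∣ c₃ ∨ 3 ∣ c_P` replaced by `1 ≤ t`, `#E(ℚ₃)[3] = 3^t`, and
the rider clause (ii₂) read at torsion exponent `t` (the SAME object: SOME Kato witnesses of the `ZetaBody` family with
finite-level functionals, (Λ)-clauses and two-exponent riders for ONE `e`; CONSTRUCTION-SHAPED, never `_holds`). -/
local notation3 (prettyPrint := false) "FINEKATOᵀ" =>
  ∀ (W : WeierstrassCurve ℚ) [W.IsElliptic] [W.IsGloballyMinimal]
    [ContinuousSMul ℤ_[3] (W.tateModule 3)] [Module.Free ℤ_[3] (W.tateModule 3)]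
    [Module.Finite ℤ_[3] (W.tateModule 3)],
    (∀ m : ℕ, W.HasSurjectiveModNGaloisRep (3 ^ m : ℕ)) →
    (haveI : Fact (Nat.Prime 3) := ⟨Nat.prime_three⟩; Addv W 3) →
    ∀ (t : ℕ), 1 ≤ t → Nat.card {Q : (W.baseChange ℚ_[3]).toAffine.Point // (3 : ℕ) • Q = 0} = 3 ^ t →
    ∀ (v₃ : HeightOneSpectrum (𝓞 ℚ)), ((3 : ℕ) : 𝓞 ℚ) ∈ v₃.asIdeal →
    ∀ {N : ℕ} [NeZero N] (P : ModularParametrizationData W N), N = W.conductorNorm ℤ →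
      (∀ z ∈ P.L.lattice, ∃ w ∈ periodLattice P.f, z = P.c * w) →
      ∃ (ι : (n : ℕ) → (CyclotomicField n ℚ →+* ℂ)) (κK : ℝ)
        (Λ : ∀ (k' : ℕ) (r : Finset (HeightOneSpectrum (𝓞 ℚ))),
          H1 (tateRep W 3) (cycSubgroup 3 k' r) →ₗ[ℤ_[3]]
            ℚ_[3] ⊗[ℚ] CyclotomicField (cycLevel 3 k' r) ℚ)
        (Λfin : ∀ j : ℕ, galoisCohomology
          ((W.torsionGaloisModule (((3 : ℕ) : ℤ) ^ j * ((3 : ℕ) : ℤ))).toLocal (Sum.inr v₃)) 1 →+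
            ZMod (3 ^ (j + 1))) (e : ℕ),
        κK ≠ 0 ∧ (∃ u : ℚ, (u : ℝ) = κK ∧ padicValRat 3 u = 0) ∧
        (∀ j : ℕ,
          (∀ c : ZMod (3 ^ (j + 1)), ∃ x ∈ propagatedSelmerStructure W 3 j (Sum.inr v₃), Λfin j x = c) ∧
          (∀ x ∈ propagatedSelmerStructure W 3 j (Sum.inr v₃),
            Λfin j x = 0 ↔ x ∈ W.kummerSelmerStructure (((3 : ℕ) : ℤ) ^ j * ((3 : ℕ) : ℤ)) (Sum.inr v₃))) ∧
        (∀ j : ℕ, RIDER₂⟦W, j, t, e, v₃, Λ, Λfin j⟧) ∧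
        ∀ (c d a : ℤ) (A : ℕ), 0 < A → Int.gcd c (6 * 3 * A) = 1 → Int.gcd d (6 * 3 * N) = 1 →
          ∃ (z : ∀ (k' : ℕ) (r : (cyclotomicLevelsRat 3 (badPlaces c d A N)).Ideals),
                H1 (tateRep W 3) ((cyclotomicLevelsRat 3 (badPlaces c d A N)).level k' r.1))
            (x : ∀ (k' : ℕ) (r : (cyclotomicLevelsRat 3 (badPlaces c d A N)).Ideals),
                CyclotomicField (cycLevel 3 k' r.1) ℚ),
            ZetaBody W 3 P.f ι κK Λ c d a A z x

/-- Local notation: **(TD)** — Tamagawa divisibility of the deep Kurihara numbers on the NON-ADDITIVE tower rows of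
analytic rank `0` with `3 ∣ ∏ c_ℓ` (seat acc2's binder `hTD` VERBATIM; Kim's Conj. 1.10 `≥`-half, deep reading —
displayed, never a fact). -/
local notation3 (prettyPrint := false) "TAMDIV" =>
  ∀ (W : WeierstrassCurve ℚ) [W.IsElliptic] [W.IsGloballyMinimal],
    (∀ n : ℕ, W.HasSurjectiveModNGaloisRep (3 ^ n : ℕ)) →
    ∀ {N : ℕ} [NeZero N] (f : CuspForm (Gamma0 N) 2), IsNewformOf W f →
    kuriharaVanishingOrder W 3 f = 0 →
    ¬ (haveI : Fact (Nat.Prime 3) := ⟨Nat.prime_three⟩; Addv W 3) → 3 ∣ W.tamagawaProduct →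
      ((padicValNat 3 W.tamagawaProduct : ℕ) : ℕ∞) ≤ kuriharaPartialDeepInfty W 3 f

/-! ### §D Crux 19679 BY NAME — (R₁) replaced by (C1₂ᵗ) + S24-DEEP -/

/-- **Crux `DeepLowerAtThreeOffKatoStratum` (item 19679) BY NAME after this seat's gen 4** — gen 3's §A
(`deepLowerAtThreeOffKatoStratum_of_stubs`) on: (`h₁`) seat acc2 gen 3's ★★★★♯′
`stub_nonAdditive_of_rungK3_of_x11aThree_sharp_of_tamagawa_le_deepInfty` (eleven named published facts, the rung-K3 leaf
`hK3`, corner X11a's `hT3`, and (TD) `hTD` — as in §B); (`h₂`) this seat's gen-4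
`stub19679_additiveDefect_of_fineKato_of_fineKatoT` from [S24] (1)(2) `hS24 hS24₂`, the S24-DEEP ports `hS24d hS24d₂`, `hGZK`,
Poitou–Tate `hPT`, the fine Kato package (C1₂) `hC1` on the `t = 0` defect rows and (C1₂ᵗ) `hC1t` on the `t ≥ 1` additive
rows.  NO row of the crux displays its own conclusion.  CONDITIONAL: does not close the item; nothing booked.
[cite: Kim2025RefinedTNC, Thm 1.1 and §8.1.2] [cite: Kim2022StructureSelmer, Thm. 1.9 (6), Thm. 3.13, Conj. 1.10 (PDF p. 8)]
[cite: Sakamoto2024, Thm. 4.4 (1)(2) (p. 926)] [cite: MazurRubin2004, Thm. 5.2.12 and App. A Prop. A.2 (pp. 79–80)]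
[cite: YanZhu2024MainConjNonCM, Thm. 4.15 (§4.6)] [cite: Wuthrich2014, Lemma 20 and Prop. 21] [cite: Skinner2016PacificMC, Thm. C (§1)]
[cite: Miller2011LMS, Thm. 1.2, Def. 1.1] [cite: Mazur1978, Cor. 4.1] [cite: Ribet1990, Thm. 1.1]
[cite: Kato2004Asterisque, §9.4 and Thm. 9.7 (pp. 188–189), Ex. 13.3 (pp. 224–225)] -/
theorem deepLowerAtThreeOffKatoStratum_of_cornerKeys_of_fineKato_of_fineKatoT
    (hYZ : YanZhu2026.thm415_padicValRat_bsd_rank_le_one)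
    (hW20 : Wuthrich2014.lemma20_surjective_threeAdic_of_semistable)
    (hW : Wuthrich2014.sha_dvd_analyticSha)
    (hSk : Skinner2016.thmC_padicValRat_bsd_rank_zero)
    (hmod : hasEntireLFunction_rat) (hGZK : rank_eq_analyticRank_of_analyticRank_le_one)
    (hM : mazur_not_dvd_maninConstant_of_odd)
    (hBCDT : exists_isNewformOf) (hLL : diamond1995_refinedSerre)
    (hMi : bsdp_of_irreducible_of_conductor_lt)
    (hS24 : Sakamoto2024.kolyvaginSystems_freeRankOne_zmod_three_pow)
    (hS24₂ : Sakamoto2024.kolyvaginSystems_idealOfBasis_eq_fittingIdeal_zmod_three_pow)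
    (hS24d : S24Deep.kolyvaginSystems_freeRankOne_zmod_three_pow_deep)
    (hS24d₂ : S24Deep.kolyvaginSystems_idealOfBasis_eq_fittingIdeal_zmod_three_pow_deep)
    (hPT : poitouTate_selmerStructure_duality ℚ)
    (hK3 : Supersingular.SignedSupersingular) (hT3 : X11a.TargetThree) (hTD : TAMDIV)
    (hC1 : FINEKATO₂) (hC1t : FINEKATOᵀ) :
    DeepLowerAtThreeOffKatoStratum :=
  deepLowerAtThreeOffKatoStratum_of_stubs
    (stub_nonAdditive_of_rungK3_of_x11aThree_sharp_of_tamagawa_le_deepInfty hYZ hW20 hW hSk hmod hGZK hM hBCDT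
      hLL hMi hK3 hT3 hTD)
    (stub19679_additiveDefect_of_fineKato_of_fineKatoT hS24 hS24₂ hS24d hS24d₂ hGZK hPT hC1 hC1t)

/-! ### §E The parent crux 19075 BY NAME -/

/-- **The PARENT crux `DeepLowerAtThree` (item 19075) BY NAME after this seat's gen 4**: seat w2-c2's §L glue
`KimAtThreeDeepLowerSplitGlue.deepLowerAtThree_of_parts` on the alias `KatoStratumSharedParts` (item 19678 = Sakamoto 2024
Thm. 4.4 ×2 ∧ GZK ∧ Poitou–Tate ∧ Carayol ∧ the PORT″ crux 19560) and §D — [S24] (1)(2), GZK and Poitou–Tate are taken FROM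
the alias.  CONDITIONAL: does not close 19075; nothing booked. [cite: Kim2025RefinedTNC, Thm 1.1]
[cite: Sakamoto2024, Thm. 4.4 (p. 926)] [cite: MazurRubin2004, Thm. 5.2.12 and App. A Prop. A.2] [cite: Carayol1986]
[cite: MilneADT2006, Ch. I, Thm. 4.10] -/
theorem deepLowerAtThree_of_katoStratumSharedParts_of_cornerKeys_of_fineKato_of_fineKatoT
    (hK : KatoStratumSharedParts)
    (hYZ : YanZhu2026.thm415_padicValRat_bsd_rank_le_one)
    (hW20 : Wuthrich2014.lemma20_surjective_threeAdic_of_semistable)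
    (hW : Wuthrich2014.sha_dvd_analyticSha)
    (hSk : Skinner2016.thmC_padicValRat_bsd_rank_zero)
    (hmod : hasEntireLFunction_rat)
    (hM : mazur_not_dvd_maninConstant_of_odd)
    (hBCDT : exists_isNewformOf) (hLL : diamond1995_refinedSerre)
    (hMi : bsdp_of_irreducible_of_conductor_lt)
    (hS24d : S24Deep.kolyvaginSystems_freeRankOne_zmod_three_pow_deep)
    (hS24d₂ : S24Deep.kolyvaginSystems_idealOfBasis_eq_fittingIdeal_zmod_three_pow_deep)
    (hK3 : Supersingular.SignedSupersingular) (hT3 : X11a.TargetThree) (hTD : TAMDIV)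
    (hC1 : FINEKATO₂) (hC1t : FINEKATOᵀ) :
    DeepLowerAtThree := by
  obtain ⟨hSak, hGZK, hPT, hlev, hPort⟩ := hK
  exact deepLowerAtThree_of_parts hSak hGZK hPT hlev hPort
    (deepLowerAtThreeOffKatoStratum_of_cornerKeys_of_fineKato_of_fineKatoT hYZ hW20 hW hSk hmod hGZK hM hBCDT
      hLL hMi hSak.1 hSak.2 hS24d hS24d₂ hPT hK3 hT3 hTD hC1 hC1t)

end Summit.BirchSwinnertonDyer.BirchSwinnertonDyer.Theorems.KimAtThreeDeepLowerOffKatoStratumAssemblyFineKatoT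

end
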